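import Summits.NavierStokesRegularity.NavierStokesRegularity.Theorems.TypeIIInviscidRelaxationAxisymSwirlRegularHalfLineBarrierCriterionVisc
import Literature.Analysis.FluidPDE.TwoPointMaximumPrinciple
import Literature.Analysis.FluidPDE.TsaiMaximumPrinciple
import HarnessLib

/-!
# The time-dependent barrier class of the one-sided radial criterion is EMPTY at every constant `C ≥ 2`

Helper toward the crux `AxisymSwirlRegular` (stmt-NavierStokesRegularity-1964, route TypeIIInviscidRelaxation),
registered line `radial_inflow_split`, criterion stub `stub_oneSidedRadialCriterion` (⟨19059⟩: `r u_r ≥ −Cν` on an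
axis tube for SOME `C` ⇒ continuation past `T`; the `C < 2` half is the tree theorem
`ScenarioCensus.LogGate.oneSidedRadialCriterion_of_lt_two`, the `C ≥ 2` half is open in print).

State of the tree.  Every landed attack on the stub is a COMPARISON of the swirl `Γ = r u_θ` with a barrier `w`
for the allowed inflow envelope `E` (`u_r ≥ −E`): time-INDEPENDENT tube barriers
(`ScenarioCensus.LogGate.tubeComparison_holds`; their class is empty for `E = C/r`, `C ≥ 2`:
`RadialInflowBarrierWall.not_isTubeBarrier_of_two_le`, p819428) and the time-DEPENDENT half-line barriers of
`RadialInflowComparisonT.hasSmoothExtensionPast_of_timeDependentBarrier_visc` /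
`RadialInflowComparisonT.hasSmoothExtensionPast_of_kappaEnvelope` (hypothesis `hB`: `w(r,s)`, `C²` on
`(0,2) × (0,S)`, continuous on `[0,2] × [0,S)`, `w(0,s) = 0`, nondecreasing in `r`, `w ≤ C' r^α` on `[0,1]`,
`w(1,s) ≥ 1`, `w(r,0) ≥ min(r,1)²`, and `w_rr − w_r/r + E·w_r ≤ w_s`), which for the κ-envelopes
`E = M r^{κ−1}(S−s)^{−κ/2}`, `0 < κ ≤ 1`, exist for EVERY `M` (`ZhangBarrier.exists_halfLineBarrierW`,
p821608).  The endpoint `κ = 0` of that family is the stub's envelope `E = M/r`.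

This file certifies, in kernel, that the time-dependent class is ALSO empty there:

* `no_halfLineBarrier_core` — for `M ≥ 2` there is no `w ≥ 0`, jointly `C²` on `(0,1) × (0,S)` and continuous on
  `[0,1] × [0,S)`, with `w(0,s) = 0`, `w(1,s) ≥ 1`, `w(r,0) ≥ r²` and `w_rr + (M−1) w_r / r ≤ w_s`
  (no monotonicity, no Hölder rate needed);
* `not_exists_halfLineBarrier_of_two_le` — hence the `hB`-class is empty for EVERY envelope `E ≥ M/r` on
  `(0,2) × (0,S)` with `M ≥ 2` (a barrier for a larger envelope is a barrier for `M/r`, as `w_r ≥ 0`);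
* `not_exists_halfLineBarrier_kappa_zero` — the input `hB` of `hasSmoothExtensionPast_of_kappaEnvelope` at
  `κ = 0` does not exist for `M ≥ 2` (BY NAME of that clause list, `κ` replaced by `0`);
* `not_exists_halfLineBarrier_oneSided` — the input of `hasSmoothExtensionPast_of_timeDependentBarrier_visc` for the
  stub's envelope `E(r,t) = Cν/r` (dilated coefficient `ν⁻¹·(Cν/r) = C/r`) does not exist for `C ≥ 2`.

Proof (elementary form of «the origin is polar for the Bessel process of dimension `M ≥ 2`»; Feller 1952).  For
`λ = 1/2`, `η > 0`, `ρ = e^{−1/η}` the explicit function `z(r,s) = λ(r² + 2Ms) + η log r` solves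
`z_s ≤ z_rr + (M−1) z_r / r` (indeed `z_rr + (M−1)z_r/r − z_s = (M−2)η/r² ≥ 0`), is `≤ r² ≤ w` at `s = 0`, `≤ −1/4 < 0 ≤ w`
at `r = ρ` (where `η log ρ = −1`) and `≤ 3/4 < 1 ≤ w` at `r = 1` for `s ≤ s₁ ≤ 1/(4M)`; the abstract weak maximum
principle `TwoPoint.weak_max_principle_localMax` on `[0,s₁] × [ρ,1]` (at an interior local maximum of `z − w`:
`w_r = z_r`, `w_rr ≥ z_rr`, so `w_s ≥ z_s` by the two differential inequalities) gives `w ≥ z` there.  Letting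
`η → 0` along `η = λMs₁/log(1/r)` yields `w(r,s₁) ≥ λMs₁ > 0` for every `0 < r < 1`, contradicting `w(0⁺,s₁) = 0`.

Reading for the line: the open half `C ≥ 2` of ⟨19059⟩ is unreachable by ANY input of the landed comparison
machinery, static or time-dependent; an attack must use more of the Navier–Stokes system than the swirl equation
with a one-sided drift bound.  Method-tightness certificate only — nothing here bears on the truth of the stub, and
nothing here proves `AxisymSwirlRegular` or NavierStokesRegularity.

References: W. Feller, Ann. of Math. 55 (1952), §§1–2 (entrance boundaries; Bessel process of dimension `≥ 2`);
G. M. Lieberman, *Second order parabolic differential equations*, World Scientific 1996, Ch. II Lemma 2.1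
(weak maximum principle) [Lieberman1996]; Q. S. Zhang, arXiv:2604.07785 (2026), §3 (half-line comparison)
[Zhang2026PartialTypeI]. [folklore]
-/

noncomputable section

set_option linter.dupNamespace false

open Set Filter Topology
open Literature.Analysis.FluidPDE

namespace Summit.NavierStokesRegularity.NavierStokesRegularity.Theorems.RadialInflowBarrierWallT

open Summit.NavierStokesRegularity.NavierStokesRegularity.Theorems.ScenarioCensus.LogGate

/-! ## §1 The core non-existence theorem

(The second-order condition at a local maximum is the tree's
`Literature.Analysis.FluidPDE.deriv_deriv_nonpos_of_isLocalMax`, `TsaiMaximumPrinciple.lean`.) -/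

/-- **No time-dependent half-line barrier at Bessel dimension `M ≥ 2`.** There is no function `w(r,s)`, jointly
`C²` on `(0,1) × (0,S)` and continuous on `[0,1] × [0,S)`, with `w(0,s) = 0`, `w ≥ 0`, `w(1,s) ≥ 1`, `w(r,0) ≥ r²`
and the supersolution inequality `w_rr − w_r/r + (M/r) w_r ≤ w_s` on `(0,1) × (0,S)`.  Proof: comparison with the
explicit subsolution `λ(r² + 2Ms) + η log r` on `[0,s₁] × [e^{−1/η}, 1]` by `TwoPoint.weak_max_principle_localMax`,
then `η → 0` (module docstring). [folklore: Feller 1952 (entrance boundary), Lieberman 1996 Ch. II Lemma 2.1] -/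
theorem no_halfLineBarrier_core {M S : ℝ} (hM : 2 ≤ M) (hS : 0 < S) {w : ℝ → ℝ → ℝ}
    (hC2j : ContDiffOn ℝ 2 (fun q : ℝ × ℝ => w q.1 q.2) (Ioo 0 1 ×ˢ Ioo 0 S))
    (hC0j : ContinuousOn (fun q : ℝ × ℝ => w q.1 q.2) (Icc 0 1 ×ˢ Ico 0 S))
    (hax : ∀ s ∈ Ico 0 S, w 0 s = 0)
    (hnn : ∀ s ∈ Ico 0 S, ∀ r ∈ Icc (0 : ℝ) 1, 0 ≤ w r s)
    (hone : ∀ s ∈ Ico 0 S, 1 ≤ w 1 s)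
    (hdat0 : ∀ r ∈ Icc (0 : ℝ) 1, r ^ 2 ≤ w r 0)
    (hpde : ∀ r ∈ Ioo (0 : ℝ) 1, ∀ s ∈ Ioo 0 S,
      iteratedDeriv 2 (fun ρ => w ρ s) r - r⁻¹ * deriv (fun ρ => w ρ s) r
          + M * r⁻¹ * deriv (fun ρ => w ρ s) r ≤ deriv (fun s' => w r s') s) : False := by
  have hM0 : 0 < M := by linarith
  -- the time horizon `s₁ = min (S/2) (1/(4M))`; the amplitude is `λ = 1/2`
  set s₁ : ℝ := min (S / 2) (1 / (4 * M)) with hs₁_def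
  have hs₁0 : 0 < s₁ := lt_min (by linarith) (by positivity)
  have hs₁S : s₁ < S := (min_le_left _ _).trans_lt (by linarith)
  have hs₁M : 2 * M * s₁ ≤ 1 / 2 := by
    calc 2 * M * s₁ ≤ 2 * M * (1 / (4 * M)) := by gcongr; exact min_le_right _ _
      _ = 1 / 2 := by field_simp; ring
  /- ### Step A: comparison with `z = λ(r² + 2Ms) + η log r` on `[0,s₁] × [e^{-1/η}, 1]` -/
  have comp : ∀ η : ℝ, 0 < η → ∀ s ∈ Icc 0 s₁, ∀ r ∈ Icc (Real.exp (-η⁻¹)) 1,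
      (1/2 : ℝ) * (r ^ 2 + 2 * M * s) + η * Real.log r ≤ w r s := by
    intro η hη
    set ρ : ℝ := Real.exp (-η⁻¹) with hρ_def
    have hρ0 : 0 < ρ := Real.exp_pos _
    have hρ1 : ρ < 1 := by
      have h : Real.exp (-η⁻¹) < Real.exp 0 := Real.exp_lt_exp.2 (by simp [hη])
      simpa [hρ_def] using h
    have hlogρ : Real.log ρ = -η⁻¹ := Real.log_exp _
    -- subsets used throughout
    have hKsub : Icc ρ 1 ⊆ Icc (0 : ℝ) 1 := Icc_subset_Icc_left hρ0.le
    have hUsub : Ioo ρ 1 ⊆ Ioo (0 : ℝ) 1 := Ioo_subset_Ioo_left hρ0.le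
    have hTsub : Icc 0 s₁ ⊆ Ico 0 S := fun t ht => ⟨ht.1, ht.2.trans_lt hs₁S⟩
    have hTsubo : Ioc 0 s₁ ⊆ Ioo 0 S := fun t ht => ⟨ht.1, ht.2.trans_lt hs₁S⟩
    -- the comparison function `W = z - w` and its time derivative
    have key : ∀ t ∈ Icc 0 s₁, ∀ x ∈ Icc ρ 1,
        (fun t x => (1/2 : ℝ) * (x ^ 2 + 2 * M * t) + η * Real.log x - w x t) t x ≤ 0 := by
      refine TwoPoint.weak_max_principle_localMax isCompact_Icc isOpen_Ioo Ioo_subset_Icc_self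
        (wₜ := fun t x => (1/2 : ℝ) * (2 * M) - deriv (fun s' => w x s') t) ?_ ?_ ?_ ?_ ?_
      · -- joint continuity on `[0,s₁] × [ρ,1]`
        have hw' : ContinuousOn (fun p : ℝ × ℝ => w p.2 p.1) (Icc 0 s₁ ×ˢ Icc ρ 1) :=
          hC0j.comp continuous_swap.continuousOn fun p hp => ⟨hKsub hp.2, hTsub hp.1⟩
        have hlog : ContinuousOn (fun p : ℝ × ℝ => η * Real.log p.2) (Icc 0 s₁ ×ˢ Icc ρ 1) :=
          continuousOn_const.mul (continuousOn_snd.log fun p hp => (hρ0.trans_le hp.2.1).ne')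
        have hpol : Continuous fun p : ℝ × ℝ => (1/2 : ℝ) * (p.2 ^ 2 + 2 * M * p.1) := by fun_prop
        exact (hpol.continuousOn.add hlog).sub hw'
      · -- time derivative on `(0,s₁] × (ρ,1)`
        intro t ht x hx
        have hx0 : 0 < x := hρ0.trans hx.1
        have hq : Ioo (0 : ℝ) 1 ×ˢ Ioo 0 S ∈ 𝓝 (x, t) :=
          (isOpen_Ioo.prod isOpen_Ioo).mem_nhds ⟨hUsub hx, hTsubo ht⟩
        have hj : DifferentiableAt ℝ (fun q : ℝ × ℝ => w q.1 q.2) (x, t) :=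
          (hC2j.contDiffAt hq).differentiableAt (by simp)
        have hm : DifferentiableAt ℝ (fun s' : ℝ => (x, s')) t :=
          (differentiableAt_const _).prodMk differentiableAt_id
        have hd : HasDerivAt (fun s' => w x s') (deriv (fun s' => w x s') t) t :=
          (hj.comp t hm).hasDerivAt
        have hz : HasDerivAt (fun s' => (1/2 : ℝ) * (x ^ 2 + 2 * M * s') + η * Real.log x) ((1/2 : ℝ) * (2 * M)) t := by
          have h1 : HasDerivAt (fun s' => (1/2 : ℝ) * (x ^ 2 + 2 * M * s')) ((1/2 : ℝ) * (2 * M * 1)) t :=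
            (((hasDerivAt_id t).const_mul (2 * M)).const_add (x ^ 2)).const_mul (1/2 : ℝ)
          simpa using h1.add_const (η * Real.log x)
        exact (hz.sub hd).hasDerivWithinAt
      · -- the differential inequalities at an interior local maximum
        intro t ht x hx hmax
        have hx0 : 0 < x := hρ0.trans hx.1
        have hxI : x ∈ Ioo (0 : ℝ) 1 := hUsub hx
        have htI : t ∈ Ioo 0 S := hTsubo ht
        -- the `r`-slice of `w` at time `t` is `C²` on `(0,1)`
        have hC2 : ContDiffOn ℝ 2 (fun ρ' => w ρ' t) (Ioo 0 1) := by
          have hm : ContDiff ℝ 2 (fun ρ' : ℝ => (ρ', t)) := contDiff_id.prodMk contDiff_const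
          exact hC2j.comp hm.contDiffOn fun ρ' hρ' => ⟨hρ', htI⟩
        have hws : ∀ y ∈ Ioo (0 : ℝ) 1, HasDerivAt (fun ρ' => w ρ' t) (deriv (fun ρ' => w ρ' t) y) y ∧
            HasDerivAt (deriv fun ρ' => w ρ' t) (iteratedDeriv 2 (fun ρ' => w ρ' t) y) y :=
          fun y hy => SliceCalc.slice_derivs hC2 hy
        -- the explicit slice `z(·,t)` and its derivatives
        have hz : ∀ y : ℝ, 0 < y → HasDerivAt (fun y => (1/2 : ℝ) * (y ^ 2 + 2 * M * t) + η * Real.log y)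
            ((1/2 : ℝ) * (2 * y) + η * y⁻¹) y := by
          intro y hy
          have h1 : HasDerivAt (fun y : ℝ => y ^ 2) (2 * y) y := by simpa using hasDerivAt_pow 2 y
          exact ((h1.add_const (2 * M * t)).const_mul (1/2 : ℝ)).add ((Real.hasDerivAt_log hy.ne').const_mul η)
        -- first derivative of `W(t,·)` on `(0,1)`
        have hW1 : ∀ y ∈ Ioo (0 : ℝ) 1,
            deriv (fun x => (1/2 : ℝ) * (x ^ 2 + 2 * M * t) + η * Real.log x - w x t) y
              = (1/2 : ℝ) * (2 * y) + η * y⁻¹ - deriv (fun ρ' => w ρ' t) y :=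
          fun y hy => ((hz y hy.1).sub (hws y hy).1).deriv
        -- at the local maximum: first-order condition
        have hcont : ContinuousAt (fun x => (1/2 : ℝ) * (x ^ 2 + 2 * M * t) + η * Real.log x - w x t) x :=
          ((hz x hx0).sub (hws x hxI).1).continuousAt
        have h1st : deriv (fun ρ' => w ρ' t) x = (1/2 : ℝ) * (2 * x) + η * x⁻¹ := by
          have h := hmax.deriv_eq_zero
          rw [hW1 x hxI] at h
          linarith
        -- second-order condition
        have h2nd : (1/2 : ℝ) * 2 - η * (x ^ 2)⁻¹ ≤ iteratedDeriv 2 (fun ρ' => w ρ' t) x := by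
          have hev : deriv (fun x => (1/2 : ℝ) * (x ^ 2 + 2 * M * t) + η * Real.log x - w x t)
              =ᶠ[𝓝 x] fun y => (1/2 : ℝ) * (2 * y) + η * y⁻¹ - deriv (fun ρ' => w ρ' t) y :=
            Filter.eventuallyEq_of_mem (isOpen_Ioo.mem_nhds hxI) fun y hy => hW1 y hy
          have hg : HasDerivAt (fun y => (1/2 : ℝ) * (2 * y) + η * y⁻¹ - deriv (fun ρ' => w ρ' t) y)
              ((1/2 : ℝ) * (2 * 1) + η * (-(x ^ 2)⁻¹) - iteratedDeriv 2 (fun ρ' => w ρ' t) x) x :=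
            ((((hasDerivAt_id x).const_mul 2).const_mul (1/2 : ℝ)).add
              ((hasDerivAt_inv hx0.ne').const_mul η)).sub (hws x hxI).2
          have h := deriv_deriv_nonpos_of_isLocalMax hmax hcont
          rw [hev.deriv_eq, hg.deriv] at h
          linarith
        -- the supersolution inequality for `w` at `(x,t)`
        have hp := hpde x hxI t htI
        rw [h1st] at hp
        have hxinv : x⁻¹ * ((1/2 : ℝ) * (2 * x) + η * x⁻¹) = 1 + η * (x ^ 2)⁻¹ := by
          rw [mul_add, ← mul_assoc x⁻¹ η, mul_comm x⁻¹ η, mul_assoc η, ← pow_two, inv_pow]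
          congr 1
          field_simp
        have hq0 : 0 ≤ η * (x ^ 2)⁻¹ := by positivity
        have hMq : 2 * (η * (x ^ 2)⁻¹) ≤ M * (η * (x ^ 2)⁻¹) := mul_le_mul_of_nonneg_right hM hq0
        have hexp : -(x⁻¹ * ((1/2 : ℝ) * (2 * x) + η * x⁻¹)) + M * x⁻¹ * ((1/2 : ℝ) * (2 * x) + η * x⁻¹)
            = (M - 1) + (M - 1) * (η * (x ^ 2)⁻¹) := by
          rw [mul_assoc M, hxinv]
          ring
        -- conclusion `W_t = z_s - w_s ≤ 0`
        show (1/2 : ℝ) * (2 * M) - deriv (fun s' => w x s') t ≤ 0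
        linarith [hp, h2nd, hexp, hMq, hq0]
      · -- bottom `s = 0`: `z(r,0) = λ r² + η log r ≤ r² ≤ w(r,0)`
        intro x hx
        have hx0 : 0 < x := hρ0.trans_le hx.1
        have hlog : η * Real.log x ≤ 0 := mul_nonpos_iff.2 (Or.inl ⟨hη.le, Real.log_nonpos hx0.le hx.2⟩)
        have hd := hdat0 x (hKsub hx)
        show (1/2 : ℝ) * (x ^ 2 + 2 * M * 0) + η * Real.log x - w x 0 ≤ 0
        nlinarith [sq_nonneg x, hlog, hd]
      · -- lateral boundary `r ∈ {ρ, 1}`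
        intro t ht x hx
        have hxK := hx.1
        have hx01 : x = ρ ∨ x = 1 := by
          rcases eq_or_lt_of_le hxK.1 with h | h
          · exact Or.inl h.symm
          rcases eq_or_lt_of_le hxK.2 with h' | h'
          · exact Or.inr h'
          exact absurd (⟨h, h'⟩ : x ∈ Ioo ρ 1) hx.2
        have htS : t ∈ Ico 0 S := hTsub ht
        have hMt : 2 * M * t ≤ 1 / 2 := le_trans (by nlinarith [ht.2, hM0]) hs₁M
        show (1/2 : ℝ) * (x ^ 2 + 2 * M * t) + η * Real.log x - w x t ≤ 0
        rcases hx01 with rfl | rfl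
        · -- `r = ρ`: `η log ρ = -1`, `w ≥ 0`
          have h1 : η * Real.log ρ = -1 := by
            rw [hlogρ, mul_neg, mul_inv_cancel₀ hη.ne']
          have h2 := hnn t htS ρ (hKsub hxK)
          have h3 : ρ ^ 2 ≤ 1 := by nlinarith [hρ0, hρ1]
          linarith [h1, h2, h3, hMt]
        · -- `r = 1`: `log 1 = 0`, `w(1,t) ≥ 1`
          have h2 := hone t htS
          simp only [Real.log_one, mul_zero, add_zero, one_pow]
          linarith [h2, hMt]
    intro s hs r hr
    have h := key s hs r hr
    simp only at h
    linarith
  /- ### Step B: `η → 0` contradicts `w(0⁺, s₁) = 0` -/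
  -- continuity of `w` at the axis point `(0, s₁)`
  have hε : 0 < (1/2 : ℝ) * M * s₁ := by positivity
  have hcont : ContinuousWithinAt (fun q : ℝ × ℝ => w q.1 q.2) (Icc 0 1 ×ˢ Ico 0 S) (0, s₁) :=
    hC0j (0, s₁) ⟨⟨le_rfl, zero_le_one⟩, hs₁0.le, hs₁S⟩
  obtain ⟨δ, hδ, hδε⟩ := Metric.continuousWithinAt_iff.1 hcont ((1/2 : ℝ) * M * s₁) hε
  set r : ℝ := min (δ / 2) (1 / 2) with hr_def
  have hr0 : 0 < r := lt_min (by linarith) (by norm_num)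
  have hr1 : r < 1 := (min_le_right _ _).trans_lt (by norm_num)
  have hrδ : r < δ := (min_le_left _ _).trans_lt (by linarith)
  have hsmall : w r s₁ < (1/2 : ℝ) * M * s₁ := by
    have hmem : ((r, s₁) : ℝ × ℝ) ∈ Icc (0 : ℝ) 1 ×ˢ Ico 0 S := ⟨⟨hr0.le, hr1.le⟩, hs₁0.le, hs₁S⟩
    have hdist : dist ((r, s₁) : ℝ × ℝ) (0, s₁) < δ := by
      rw [Prod.dist_eq, dist_self, Real.dist_eq, sub_zero, abs_of_pos hr0, max_eq_left hr0.le]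
      exact hrδ
    have h := hδε hmem hdist
    rw [hax s₁ ⟨hs₁0.le, hs₁S⟩, Real.dist_eq, sub_zero] at h
    exact lt_of_abs_lt h
  -- the choice `η = λ M s₁ / log(1/r)`
  have hlogr : Real.log r < 0 := Real.log_neg hr0 hr1
  set L : ℝ := -Real.log r with hL_def
  have hL0 : 0 < L := by rw [hL_def]; linarith
  set η : ℝ := (1/2 : ℝ) * M * s₁ / L with hη_def
  have hη0 : 0 < η := div_pos hε hL0
  have hηlog : η * Real.log r = -((1/2 : ℝ) * M * s₁) := by
    have : Real.log r = -L := by rw [hL_def]; ring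
    rw [this, hη_def]
    field_simp
  have hc1 : (1/2 : ℝ) * M * s₁ ≤ 1 := by linarith [hs₁M]
  have hexp : Real.exp (-η⁻¹) ≤ r := by
    rw [← Real.exp_log hr0, Real.exp_le_exp]
    have h1 : -η⁻¹ = Real.log r / ((1/2 : ℝ) * M * s₁) := by
      rw [hη_def, inv_div, hL_def]
      ring
    rw [h1, div_le_iff₀ hε]
    nlinarith [hlogr, hc1]
  have hbig := comp η hη0 s₁ ⟨hs₁0.le, le_rfl⟩ r ⟨hexp, hr1.le⟩
  rw [hηlog] at hbig
  nlinarith [hbig, hsmall, sq_nonneg r, hε]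

/-! ## §2 The barrier class of the landed engine, by name of its clauses -/

/-- **No half-line barrier for any envelope at least `2/r`-singular at the axis.** For `M ≥ 2` and an inflow
envelope `E ≥ M/r` on `(0,2) × (0,S)`, the clause list `hB` of
`RadialInflowComparisonT.hasSmoothExtensionPast_of_kappaEnvelope` /
`RadialInflowComparisonT.hasSmoothExtensionPast_of_timeDependentBarrier_visc` (with `E` as the drift coefficient)
has NO witness `(α, C, w)`.  Reduction to `no_halfLineBarrier_core`: restrict to `(0,1) × (0,S)`, `w ≥ 0` and
`w_r ≥ 0` from `w(0,s) = 0` + monotonicity, so `(M/r) w_r ≤ E w_r`. [folklore] -/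
theorem not_exists_halfLineBarrier_of_two_le {M S : ℝ} {E : ℝ → ℝ → ℝ} (hM : 2 ≤ M) (hS : 0 < S)
    (hE : ∀ r ∈ Ioo (0 : ℝ) 2, ∀ s ∈ Ioo 0 S, M * r⁻¹ ≤ E r s) :
    ¬ ∃ (α C : ℝ) (w : ℝ → ℝ → ℝ), 0 < α ∧ α ≤ 1 ∧ 0 < C ∧
      ContDiffOn ℝ 2 (fun q : ℝ × ℝ => w q.1 q.2) (Ioo 0 2 ×ˢ Ioo 0 S) ∧
      ContinuousOn (fun q : ℝ × ℝ => w q.1 q.2) (Icc 0 2 ×ˢ Ico 0 S) ∧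
      (∀ s ∈ Ico 0 S, w 0 s = 0 ∧ MonotoneOn (fun r => w r s) (Icc 0 2) ∧
        (∀ r ∈ Icc (0 : ℝ) 1, w r s ≤ C * r ^ α) ∧ 1 ≤ w 1 s) ∧
      (∀ r ∈ Icc (0 : ℝ) 2, min r 1 ^ 2 ≤ w r 0) ∧
      (∀ r ∈ Ioo (0 : ℝ) 2, ∀ s ∈ Ioo 0 S,
        iteratedDeriv 2 (fun ρ => w ρ s) r - r⁻¹ * deriv (fun ρ => w ρ s) r
            + E r s * deriv (fun ρ => w ρ s) r ≤ deriv (fun s' => w r s') s) := by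
  rintro ⟨α, C, w, -, -, -, hC2j, hC0j, hsl, hdat0, hpde⟩
  have h12 : Ioo (0 : ℝ) 1 ⊆ Ioo 0 2 := Ioo_subset_Ioo_right one_le_two
  have h12c : Icc (0 : ℝ) 1 ⊆ Icc 0 2 := Icc_subset_Icc_right one_le_two
  refine no_halfLineBarrier_core (M := M) hM hS (w := w) (hC2j.mono (prod_mono h12 Subset.rfl))
    (hC0j.mono (prod_mono h12c Subset.rfl)) (fun s hs => (hsl s hs).1) ?_ (fun s hs => (hsl s hs).2.2.2) ?_ ?_
  · -- `w ≥ 0` on `[0,1]` from `w(0,s) = 0` and monotonicity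
    intro s hs r hr
    obtain ⟨h0, hmon, -, -⟩ := hsl s hs
    have h := hmon ⟨le_rfl, zero_le_two⟩ (h12c hr) hr.1
    simpa [h0] using h
  · -- the initial floor on `[0,1]`
    intro r hr
    have h := hdat0 r (h12c hr)
    rwa [min_eq_left hr.2] at h
  · -- the supersolution inequality with the smaller drift `M/r ≤ E`
    intro r hr s hs
    have hmon := (hsl s ⟨hs.1.le, hs.2⟩).2.1
    have hd0 : 0 ≤ deriv (fun ρ => w ρ s) r := by
      rw [← derivWithin_of_mem_nhds (Icc_mem_nhds hr.1 (hr.2.trans one_lt_two))]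
      exact hmon.derivWithin_nonneg
    have h1 : M * r⁻¹ * deriv (fun ρ => w ρ s) r ≤ E r s * deriv (fun ρ => w ρ s) r :=
      mul_le_mul_of_nonneg_right (hE r (h12 hr) s hs) hd0
    exact le_trans (by linarith) (hpde r (h12 hr) s hs)

/-- **The κ-envelope engine has no input at `κ = 0`, `M ≥ 2`.** The hypothesis `hB` of
`RadialInflowComparisonT.hasSmoothExtensionPast_of_kappaEnvelope` with `κ` replaced by `0` (envelope
`M ν r^{−1}`, i.e. the one-sided gate `r u_r ≥ −Mν` of ⟨19059⟩/⟨19060⟩; dilated drift coefficient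
`M r^{0−1}(νT−s)^{−0/2} = M/r`) is unsatisfiable for every `M ≥ 2`, `ν, T > 0` — complementing
`ZhangBarrier.exists_halfLineBarrierW` (a witness for every `0 < κ ≤ 1` and every `M > 0`) and the static
`RadialInflowBarrierWall.exists_isTubeBarrier_iff_lt_two`. [folklore] -/
theorem not_exists_halfLineBarrier_kappa_zero {M ν T : ℝ} (hM : 2 ≤ M) (hν : 0 < ν) (hT : 0 < T) :
    ¬ ∃ (α C : ℝ) (w : ℝ → ℝ → ℝ), 0 < α ∧ α ≤ 1 ∧ 0 < C ∧
      ContDiffOn ℝ 2 (fun q : ℝ × ℝ => w q.1 q.2) (Ioo 0 2 ×ˢ Ioo 0 (ν * T)) ∧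
      ContinuousOn (fun q : ℝ × ℝ => w q.1 q.2) (Icc 0 2 ×ˢ Ico 0 (ν * T)) ∧
      (∀ s ∈ Ico 0 (ν * T), w 0 s = 0 ∧ MonotoneOn (fun r => w r s) (Icc 0 2) ∧
        (∀ r ∈ Icc (0 : ℝ) 1, w r s ≤ C * r ^ α) ∧ 1 ≤ w 1 s) ∧
      (∀ r ∈ Icc (0 : ℝ) 2, min r 1 ^ 2 ≤ w r 0) ∧
      (∀ r ∈ Ioo (0 : ℝ) 2, ∀ s ∈ Ioo 0 (ν * T),
        iteratedDeriv 2 (fun ρ => w ρ s) r - r⁻¹ * deriv (fun ρ => w ρ s) r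
            + M * r ^ ((0 : ℝ) - 1) * (ν * T - s) ^ (-((0 : ℝ) / 2)) * deriv (fun ρ => w ρ s) r
          ≤ deriv (fun s' => w r s') s) := by
  refine not_exists_halfLineBarrier_of_two_le (E := fun r s => M * r ^ ((0 : ℝ) - 1) * (ν * T - s) ^ (-((0 : ℝ) / 2)))
    hM (mul_pos hν hT) fun r hr s _ => ?_
  have h : M * r ^ ((0 : ℝ) - 1) * (ν * T - s) ^ (-((0 : ℝ) / 2)) = M * r⁻¹ := by
    rw [zero_sub, Real.rpow_neg_one, zero_div, neg_zero, Real.rpow_zero, mul_one]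
  rw [h]

/-- **No time-dependent barrier for the stub's envelope at `C ≥ 2`.** For the one-sided gate of ⟨19059⟩ at viscosity
`ν` — `u_r ≥ −E(r,t)`, `E(r,t) = Cν/r` (i.e. `r u_r ≥ −Cν`) — the barrier demanded by
`RadialInflowComparisonT.hasSmoothExtensionPast_of_timeDependentBarrier_visc` (its clauses `hC2j, hC0j, hsl, hdat0,
hpde`, the last with the dilated coefficient `ν⁻¹·E(r, ν⁻¹s) = ν⁻¹(Cν/r)`) does not exist when `C ≥ 2`: together
with `RadialInflowBarrierWall.not_isTubeBarrier_of_two_le` (time-independent barriers) this exhausts the inputs of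
the landed comparison machinery on the open half of the stub. [folklore] -/
theorem not_exists_halfLineBarrier_oneSided {C ν T : ℝ} (hC : 2 ≤ C) (hν : 0 < ν) (hT : 0 < T) :
    ¬ ∃ (α C' : ℝ) (w : ℝ → ℝ → ℝ), 0 < α ∧ α ≤ 1 ∧ 0 < C' ∧
      ContDiffOn ℝ 2 (fun q : ℝ × ℝ => w q.1 q.2) (Ioo 0 2 ×ˢ Ioo 0 (ν * T)) ∧
      ContinuousOn (fun q : ℝ × ℝ => w q.1 q.2) (Icc 0 2 ×ˢ Ico 0 (ν * T)) ∧
      (∀ s ∈ Ico 0 (ν * T), w 0 s = 0 ∧ MonotoneOn (fun r => w r s) (Icc 0 2) ∧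
        (∀ r ∈ Icc (0 : ℝ) 1, w r s ≤ C' * r ^ α) ∧ 1 ≤ w 1 s) ∧
      (∀ r ∈ Icc (0 : ℝ) 2, min r 1 ^ 2 ≤ w r 0) ∧
      (∀ r ∈ Ioo (0 : ℝ) 2, ∀ s ∈ Ioo 0 (ν * T),
        iteratedDeriv 2 (fun ρ => w ρ s) r - r⁻¹ * deriv (fun ρ => w ρ s) r
            + ν⁻¹ * ((fun r' _ : ℝ => C * ν / r') r (ν⁻¹ * s)) * deriv (fun ρ => w ρ s) r
          ≤ deriv (fun s' => w r s') s) := by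
  refine not_exists_halfLineBarrier_of_two_le (E := fun r s => ν⁻¹ * ((fun r' _ : ℝ => C * ν / r') r (ν⁻¹ * s)))
    hC (mul_pos hν hT) fun r hr s _ => ?_
  have h : ν⁻¹ * (C * ν / r) = C * r⁻¹ := by
    field_simp
  simp only [h, le_refl]

end Summit.NavierStokesRegularity.NavierStokesRegularity.Theorems.RadialInflowBarrierWallT

end
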